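import Summits.ValiantsHypothesis.ValiantsHypothesis.Theorems.KPlusLogSqLawTropicalBDoublingSigned
import Summits.ValiantsHypothesis.ValiantsHypothesis.Theorems.KPlusLogSqLawTropicalBPadding

/-!
# `TropicalB` — the balanced doubling law FROM A THRESHOLD `s(K)` ON, and the two-piece composition
# «square tower ∧ doubling from size `K²` on ⟹ TropicalB» (kernel compositions; hypotheses NOT claimed)

HONEST FRAMING.  Object-search cell `pub-symmetroid` (Valiant); helper for the OPEN crux `TropicalB` (stmt-ValiantsHypothesis-19771,
route `KPlusLogSqLaw`).  Typed VERBATIM from the ideation seat's farm-checked sketch `HOME/pub-symmetroid-conjb-2/g8/Sketch_g8.lean`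
(conjb-2 g8, memo ROUND1f, 2026-08-26; namespace `.ConjB2G8` renamed `.SquareDoubling`; the one-line honesty lemma `squareTower_of_tropicalB'` and its `…ShadowCap` import omitted), so that the authorised third line
`Cruxes/TropicalB/Lines/square-doubling.lean` (desk R1571/R1573, director 2026-08-26) can conclude the crux BY NAME through a landed
composition, as `Lines/doubling.lean` does through `Doubling.tropicalB_of_signedDoubling`.  Nothing here asserts `TropicalB`, the square
tower, any doubling law, Conjecture B, `MatrixDescartes` (stmt-ValiantsHypothesis-18050) or anything on `VP ≠ VNP`; no stub is touched or
registered by this file.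

* `DoublingFrom s c` — the SIGNED balanced doubling law asked only for balanced splits `a + e` with `s K ≤ a ≤ e ≤ a + 1`
  (`s K = K` is the registered stub `stub_signedDoubling` of `Cruxes/TropicalB/Lines/doubling.lean`: `doublingFrom_id_iff`).
* `tropRootLawAt_of_doublingFrom` / `tropicalB_of_doublingFrom` — dyadic induction from ANY base `T(m, K) ≤ 2^{C₁ K}` valid for
  `m ≤ 4·s(K)`: `DoublingFrom s c` + base ⟹ `TropicalB` with `C = C₁ + 6(c+2)` (trop-p2's `Doubling.tropRowD_of_doubling_ge`, thresholds
  generalised, signed rows).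
* `tropicalB_of_doublingLinear` — threshold `s K = λ·K` (any `λ ≥ 1`): base = slope counting (`2^{(4λ+1)K}` at `m ≤ 4λK`), so the law
  ALONE gives the crux.
* `SquareTower` (`T(K², K) ≤ 2^{C K}`; BELOW the crux: trop-p5's `squareTower_of_tropicalB` in `…TropicalBShadowCap`, not imported here) and
  `tropicalB_of_squareTower_of_doublingSq` — threshold `s K = K²`: base = square tower at `2K` + size/class padding (`tropRootLawAt_of_le`),
  so **SquareTower ∧ DoublingFrom (K ↦ K²) c ⟹ TropicalB** — a two-piece composition in which neither piece is known to give the crux alone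
  (the law from `K²` on with a COUNTING base only reaches `2^{O(K log K)}·m^{O(log m)}`).
-/

-- `Summit.ValiantsHypothesis.ValiantsHypothesis.…` is the tree's mandated single-conjunct layout (Sub = Summit).
set_option linter.dupNamespace false
set_option autoImplicit false

namespace Summit.ValiantsHypothesis.ValiantsHypothesis.Theorems.KPlusLogSqLaw

open Summit.ValiantsHypothesis.ValiantsHypothesis.Theorems.MatrixDescartes.Negative
open Summit.ValiantsHypothesis.ValiantsHypothesis.Theorems.LacunarySymmetroidMatrixDescartes
open Summit.ValiantsHypothesis.ValiantsHypothesis.Theorems.LacunarySymmetroidMatrixDescartes.TropicalCensus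
open Summit.ValiantsHypothesis.ValiantsHypothesis.Theses.KPlusLogSqLaw

namespace SquareDoubling

/-- [definition of the cell] the signed balanced doubling law from threshold `s` on, exponent `c`; NOT asserted. -/
def DoublingFrom (s : ℕ → ℕ) (c : ℕ) : Prop :=
  ∀ (K a e B₁ B₂ : ℕ), s K ≤ a → a ≤ e → e ≤ a + 1 → TropRootLawAt a K B₁ → TropRootLawAt e K B₂ →
    TropRootLawAt (a + e) K ((a + e) ^ c * (B₁ + B₂ + 2))

/-- the registered stub's law is `DoublingFrom id`. [bookkeeping] -/
theorem doublingFrom_id_iff (c : ℕ) :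
    DoublingFrom (fun K => K) c ↔
      ∀ (K a e B₁ B₂ : ℕ), K ≤ a → a ≤ e → e ≤ a + 1 → TropRootLawAt a K B₁ → TropRootLawAt e K B₂ →
        TropRootLawAt (a + e) K ((a + e) ^ c * (B₁ + B₂ + 2)) := Iff.rfl

/-- monotonicity in the threshold: a later threshold asks less. [bookkeeping] -/
theorem doublingFrom_mono {s s' : ℕ → ℕ} {c : ℕ} (hss' : ∀ K, s K ≤ s' K) (h : DoublingFrom s c) : DoublingFrom s' c :=
  fun K a e B₁ B₂ hsa hae hea h₁ h₂ => h K a e B₁ B₂ ((hss' K).trans hsa) hae hea h₁ h₂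

/-- **dyadic induction from a threshold**: under `DoublingFrom s c` and a base `T(m,K) ≤ 2^{C₁K}` for `m ≤ 4·s K`, every format `m ≤ 2^t`
has `T(m, K) ≤ 2^{C₁K}·2^{(c+2)(t+1)²}`. [folklore] -/
theorem tropRootLawAt_of_doublingFrom {s : ℕ → ℕ} {c C₁ : ℕ} (hD : DoublingFrom s c) (K : ℕ) (hs : 1 ≤ s K)
    (hbase : ∀ m, m ≤ 4 * s K → TropRootLawAt m K (2 ^ (C₁ * K)))
    (t m : ℕ) (hm : m ≤ 2 ^ t) : TropRootLawAt m K (2 ^ (C₁ * K) * 2 ^ ((c + 2) * (t + 1) ^ 2)) := by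
  have hM : 1 ≤ 2 ^ (C₁ * K) := Nat.one_le_two_pow
  induction t generalizing m with
  | zero =>
    have hm4 : m ≤ 4 * s K := by
      have : m ≤ 1 := by simpa using hm
      omega
    refine tropRootLawAt_mono ?_ (hbase m hm4)
    have : 1 ≤ 2 ^ ((c + 2) * (0 + 1) ^ 2) := Nat.one_le_two_pow
    nlinarith
  | succ t ih =>
    by_cases hsmall : m ≤ 2 ^ t
    · refine tropRootLawAt_mono ?_ (ih m hsmall)
      exact Nat.mul_le_mul_left _ (Nat.pow_le_pow_right (by norm_num)
        (Nat.mul_le_mul_left _ (Nat.pow_le_pow_left (Nat.le_succ _) 2)))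
    · by_cases hm4 : m ≤ 4 * s K
      · refine tropRootLawAt_mono ?_ (hbase m hm4)
        have : 1 ≤ 2 ^ ((c + 2) * (t + 1 + 1) ^ 2) := Nat.one_le_two_pow
        nlinarith
      · push Not at hsmall hm4
        set a := m / 2 with ha
        set e := m - m / 2 with he
        have hme : m = a + e := by omega
        have hsa : s K ≤ a := by omega
        have hae : a ≤ e := by omega
        have hea : e ≤ a + 1 := by omega
        have hm2 : m ≤ 2 ^ t + 2 ^ t := by rw [pow_succ] at hm; omega
        have hat : a ≤ 2 ^ t := by omega
        have het : e ≤ 2 ^ t := by omega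
        have h := hD K a e _ _ hsa hae hea (ih a hat) (ih e het)
        rw [hme]
        refine tropRootLawAt_mono ?_ h
        rw [← hme]
        have hmpow : m ^ c ≤ 2 ^ (c * (t + 1)) := by
          rw [mul_comm, pow_mul]
          exact Nat.pow_le_pow_left hm c
        calc m ^ c * (2 ^ (C₁ * K) * 2 ^ ((c + 2) * (t + 1) ^ 2) + 2 ^ (C₁ * K) * 2 ^ ((c + 2) * (t + 1) ^ 2) + 2)
            = m ^ c * (2 * (2 ^ (C₁ * K) * 2 ^ ((c + 2) * (t + 1) ^ 2)) + 2) := by ring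
          _ ≤ 2 ^ (c * (t + 1)) * (2 * (2 ^ (C₁ * K) * 2 ^ ((c + 2) * (t + 1) ^ 2)) + 2) := Nat.mul_le_mul_right _ hmpow
          _ ≤ 2 ^ (C₁ * K) * 2 ^ ((c + 2) * (t + 1 + 1) ^ 2) := Doubling.budget_step_mul c _ t hM

/-- exponent bookkeeping shared by the compositions: `C₁K + (c+2)(L+2)² ≤ (C₁ + 6(c+2))(K + L²)` once `K ≥ 1`. [arithmetic] -/
theorem exp_budget (C₁ c K L : ℕ) (hK : 1 ≤ K) :
    C₁ * K + (c + 2) * (L + 1 + 1) ^ 2 ≤ (C₁ + 6 * (c + 2)) * (K + L ^ 2) := by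
  have h4 : (L + 1 + 1) ^ 2 ≤ 3 * L ^ 2 + 6 := by nlinarith [sq_nonneg ((L : ℤ) - 1)]
  nlinarith

/-- **the doubling law from threshold `s` on, plus a base up to `4·s`, gives `TropicalB`** (`C = C₁ + 6(c+2)`).  Hypotheses NOT claimed. [folklore] -/
theorem tropicalB_of_doublingFrom {s : ℕ → ℕ} {c C₁ : ℕ} (hD : DoublingFrom s c) (hs : ∀ K, 1 ≤ K → 1 ≤ s K)
    (hbase : ∀ K m, 1 ≤ K → m ≤ 4 * s K → TropRootLawAt m K (2 ^ (C₁ * K))) : TropicalB := by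
  refine ⟨C₁ + 6 * (c + 2), fun m K => ?_⟩
  show TropRootLawAt m K (2 ^ ((C₁ + 6 * (c + 2)) * (K + Nat.log 2 m ^ 2)))
  rcases Nat.eq_zero_or_pos K with rfl | hK
  · exact tropRootLawAt_zero m _
  set L := Nat.log 2 m with hL
  have hm : m ≤ 2 ^ (L + 1) := (Nat.lt_pow_succ_log_self one_lt_two m).le
  have h1 := tropRootLawAt_of_doublingFrom hD K (hs K hK) (hbase K · hK) (L + 1) m hm
  refine tropRootLawAt_mono ?_ h1
  calc 2 ^ (C₁ * K) * 2 ^ ((c + 2) * (L + 1 + 1) ^ 2) = 2 ^ (C₁ * K + (c + 2) * (L + 1 + 1) ^ 2) := (pow_add _ _ _).symm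
    _ ≤ 2 ^ ((C₁ + 6 * (c + 2)) * (K + L ^ 2)) := Nat.pow_le_pow_right (by norm_num) (exp_budget C₁ c K L hK)

/-! ### Threshold `λ·K`: the law alone gives the crux (base = slope counting) -/

/-- slope counting below `4λK`: `T(m, K) ≤ 2^{(4λ+1)K}`. [tree: `tropRowD_choose`, signs via `tropRootLawAt_of_tropRowD`] -/
theorem tropRootLawAt_small_linear (lam : ℕ) {m K : ℕ} (hm : m ≤ 4 * (lam * K)) :
    TropRootLawAt m K (2 ^ ((4 * lam + 1) * K)) := by
  refine tropRootLawAt_of_tropRowD (tropRowD_mono ?_ (tropRowD_choose m K))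
  calc (K + m - 1).choose m - 1 ≤ (K + m - 1).choose m := Nat.sub_le _ _
    _ ≤ 2 ^ (K + m - 1) := Nat.choose_le_two_pow _ _
    _ ≤ 2 ^ ((4 * lam + 1) * K) := by
        refine Nat.pow_le_pow_right (by norm_num) ((Nat.sub_le _ _).trans ?_)
        nlinarith

/-- **the doubling law from size `λK` on (`λ ≥ 1`) implies `TropicalB`**, `C = (4λ+1) + 6(c+2)`.  For `λ = 1` this is trop-p2's
`Doubling.tropicalB_of_signedDoubling` up to the constant; for `λ > 1` the hypothesis is WEAKER (it is silent on the pairs `(a, 2a)` with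
`K ≤ a < λK`, where slope-counting tightness — ratio `((2λ'+1)/(λ'+1))^{K−1}` at `a = λ'K` — would kill the `λ = 1` law).  NOT claimed. [folklore] -/
theorem tropicalB_of_doublingLinear {lam c : ℕ} (hlam : 1 ≤ lam) (hD : DoublingFrom (fun K => lam * K) c) : TropicalB :=
  tropicalB_of_doublingFrom (C₁ := (4 * lam + 1)) hD (fun K hK => by show 1 ≤ lam * K; nlinarith)
    (fun K m _ hm => tropRootLawAt_small_linear lam hm)

/-- the `∃ λ` form: SOME linear threshold suffices. [folklore] -/
theorem tropicalB_of_exists_doublingLinear (h : ∃ lam c : ℕ, 1 ≤ lam ∧ DoublingFrom (fun K => lam * K) c) : TropicalB := by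
  obtain ⟨lam, c, hlam, hD⟩ := h
  exact tropicalB_of_doublingLinear hlam hD

/-! ### Threshold `K²`: square tower + doubling from size `K²` on -/

/-- [candidate of the cell; NOT asserted] the SQUARE TOWER (trop-p5 / desk docket D1a): `T(K², K) ≤ 2^{CK}`. -/
def SquareTower : Prop := ∃ C : ℕ, ∀ K : ℕ, TropRootLawAt (K ^ 2) K (2 ^ (C * K))

-- honesty (not restated here, to keep this file one import level off the route file): the square tower is BELOW the crux —
-- `squareTower_of_tropicalB : TropicalB → ∃ C, ∀ K, TropRootLawAt (K ^ 2) K (2 ^ (C * K))` in `…Theorems.KPlusLogSqLawTropicalBShadowCap` (trop-p5).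

/-- base from the square tower: for `m ≤ 4K²`, `T(m, K) ≤ T((2K)², 2K) ≤ 2^{2C₀K}` (size and class padding `tropRootLawAt_of_le`). [folklore] -/
theorem tropRootLawAt_small_sq {C₀ : ℕ} (hST : ∀ K : ℕ, TropRootLawAt (K ^ 2) K (2 ^ (C₀ * K))) {m K : ℕ} (hm : m ≤ 4 * K ^ 2) :
    TropRootLawAt m K (2 ^ (2 * C₀ * K)) := by
  have h := hST (2 * K)
  have hm' : m ≤ (2 * K) ^ 2 := by nlinarith
  have h' := tropRootLawAt_of_le hm' (by omega : K ≤ 2 * K) h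
  have hexp : C₀ * (2 * K) = 2 * C₀ * K := by ring
  rw [hexp] at h'
  exact h'

/-- **SQUARE TOWER ∧ DOUBLING FROM SIZE `K²` ON ⟹ `TropicalB`** (`C = 2C₀ + 6(c+2)`).  Two pieces; neither is known to give the crux alone
(the square tower is below it; the law from `K²` on with a COUNTING base only reaches `2^{O(K log K)}·m^{O(log m)}`).  NOT claimed. [folklore] -/
theorem tropicalB_of_squareTower_of_doublingSq {c : ℕ} (hST : SquareTower) (hD : DoublingFrom (fun K => K ^ 2) c) : TropicalB := by
  obtain ⟨C₀, hC₀⟩ := hST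
  exact tropicalB_of_doublingFrom (C₁ := 2 * C₀) hD (fun K hK => by show 1 ≤ K ^ 2; nlinarith)
    (fun K m _ hm => tropRootLawAt_small_sq hC₀ hm)

/-- the thresholds compare: the registered law (`s = id`) gives the `λK` law for every `λ ≥ 1`, which gives the `K²` law … no: `λK ≤ K²` needs
`λ ≤ K`; what holds for all `K` is `id ≤ (· ^ 2)` from `K ≥ 1` and trivially at `0`. [bookkeeping] -/
theorem doublingSq_of_doublingId {c : ℕ} (h : DoublingFrom (fun K => K) c) : DoublingFrom (fun K => K ^ 2) c :=
  doublingFrom_mono (fun K => by rcases Nat.eq_zero_or_pos K with rfl | hK <;> nlinarith) h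

end SquareDoubling

end Summit.ValiantsHypothesis.ValiantsHypothesis.Theorems.KPlusLogSqLaw
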